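import Literature.NumberTheory.LFunctions.ZetaConvexityExplicit
import Literature.NumberTheory.LFunctions.LehmanCriticalLineBoundProofs
import Literature.NumberTheory.LFunctions.ZetaOneLineBounds
import HarnessLib

/-!
# The convexity bound for `ζ` in the critical strip, unconditional and explicit:
# `|ζ(σ+it)| ≤ 32 · t^{(1−σ)/2} · log t` (`½ ≤ σ ≤ 1`, `t ≥ 8`) (Titchmarsh §5.1, (5.1.4))

Topic `Literature/NumberTheory/LFunctions` (trunk T-ANT), family RH. RH-FREE classical analysis;
nothing here bears on the zeros of `ζ` or on the truth of RH. Everything in this file is PROVED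
(no named facts, no definitions).

Titchmarsh, *The Theory of the Riemann Zeta-Function*, 2nd ed. (1986), §5.1, eq. (5.1.4):
"`ζ(s) = O(t^{½(1−σ)} log t)` uniformly in `0 ≤ σ ≤ 1`" — the CONVEXITY BOUND (`μ(σ) ≤ ½(1 − σ)`),
obtained by the Phragmén–Lindelöf principle from `ζ(½ + it) = O(t^{1/4})` and `ζ(1 + δ + it) = O(1)`.
Here it is proved on `½ ≤ σ ≤ 1` with an EXPLICIT constant, from inputs that are all theorems of the
tree:

* Lehman's critical-line bound `|ζ(½ + it)| ≤ 2.53 t^{1/4}` for all `t > 1`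
  (`Literature.NumberTheory.LFunctions.Trudgian2011_lemma_2_5_allT_holds`,
  `LehmanCriticalLineBoundProofs.lean`: the Riemann–Siegel integral for `t ≥ 128π` plus kernel
  certificates on `1 ≤ t ≤ 404`), in its all-`u` shape
  `Literature.NumberTheory.LFunctions.norm_riemannZeta_half_line_le_allT`
  (`K = 2.53`, `Q = 5/2`, `θ = ¼`);
* Rademacher's explicit Phragmén–Lindelöf theorem for `ζ₁ = (s−1)ζ(s)` between `σ = ½` and `σ = c`,
  `Literature.NumberTheory.LFunctions.norm_riemannZeta_le_convexity` (`ZetaConvexityExplicit.lean`);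
* `|ζ(1 + x)| ≤ 3/x` for `0 < x ≤ 1` (`Literature.NumberTheory.LFunctions.ZetaOneLine.norm_riemannZeta_one_add_le`).

The point of the proof is Titchmarsh's: Rademacher's bound is applied AT EACH POINT `s = σ + it`
with the moving abscissa `c = 1 + 1/log t`, so that `ζ(c) ≤ 3 log t` while the exponent
`¼·(c − σ)/(c − ½)` exceeds `(1 − σ)/2` by at most `η(2σ − 1)/(2 + 4η) ≤ 1/(2 log t)` (`η = 1/log t`),
which costs only the constant factor `t^{1/(2 log t)} = e^{1/2}`.

* `Literature.NumberTheory.LFunctions.norm_riemannZeta_le_convexity_strip` — **(5.1.4), explicit**: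
  `‖ζ(σ + it)‖ ≤ 32 · t^{(1−σ)/2} · log t` for `½ ≤ σ ≤ 1`, `t ≥ 8`
  (`32 ≥ 2.53 · 3 · (2^{1/4} e^{1/2}) · 2`).
* `Literature.NumberTheory.LFunctions.exists_norm_riemannZeta_le_convexity_strip` — the `∃ C₀ t₀` form;
  `Literature.NumberTheory.LFunctions.zetaStripBound_half` — the exponent written `(1/2)·(1 − σ)`.

This is the `ζ`-input «strip profile `μ(σ) ≤ λ(1 − σ)` with `λ = ½`» of the comparison zone of the
rh-jensen log-band line (cell HOME `rh-jensen-idea-1/TRANSFER-LENS-5.md`, `bc/SigCheck.lean` v3: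
`ZetaStripBound (1/2) C₀ t₀`, `ZetaConvexityBound`); the profile `λ = 1` (Titchmarsh (3.5.3)) is
`ZetaTrivialStripBound.lean` and the companion `‖ζ(σ+it) − 1‖ ≤ ζ(σ) − 1` (`σ > 1`) is
`ZetaSubOneVerticalSup.lean`. Stated here in plain form for general use.

## References

* E. C. Titchmarsh, *The Theory of the Riemann Zeta-Function*, 2nd ed. (rev. D. R. Heath-Brown),
  Oxford 1986, §5.1, eqs. (5.1.3)–(5.1.4). [Titchmarsh1986]
* H. Rademacher, *On the Phragmén–Lindelöf theorem and some applications*, Math. Z. 72 (1959),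
  192–204, Thm 2. [Rademacher1959]
* T. S. Trudgian, *Improvements to Turing's method*, Math. Comp. 80 (2011), Lemma 2.5, Lemma 2.7.
  [Trudgian2011]
-/

noncomputable section

open Complex Real Set

namespace Literature.NumberTheory.LFunctions

/-! ### Three numerical constants -/

/-- `2 < log 8` (`e² < 7.39 < 8`). [folklore] -/
private theorem two_lt_log_eight : (2 : ℝ) < Real.log 8 := by
  rw [Real.lt_log_iff_exp_lt (by norm_num : (0 : ℝ) < 8)]
  have h := Real.exp_one_lt_d9
  have h2 : Real.exp 2 = Real.exp 1 * Real.exp 1 := by rw [← Real.exp_add]; norm_num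
  rw [h2]
  nlinarith [Real.exp_pos 1]

/-- `e^{1/2} ≤ 5/3` (`(5/3)² = 25/9 > e`). [folklore] -/
private theorem exp_half_le : Real.exp (1 / 2) ≤ 5 / 3 := by
  have h := Real.exp_one_lt_d9
  have hsq : Real.exp (1 / 2) * Real.exp (1 / 2) = Real.exp 1 := by
    rw [← Real.exp_add]; norm_num
  by_contra hc
  rw [not_le] at hc
  nlinarith [Real.exp_pos (1 / 2 : ℝ)]

/-- `2^{1/4} ≤ 6/5` (`(6/5)⁴ = 1296/625 > 2`). [folklore] -/
private theorem two_rpow_quarter_le : (2 : ℝ) ^ (1 / 4 : ℝ) ≤ 6 / 5 := by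
  by_contra hc
  rw [not_le] at hc
  have h0 : (0 : ℝ) ≤ 6 / 5 := by norm_num
  have h4 : ((6 : ℝ) / 5) ^ 4 < ((2 : ℝ) ^ (1 / 4 : ℝ)) ^ 4 := pow_lt_pow_left₀ hc h0 (by norm_num)
  have hpow : ((2 : ℝ) ^ (1 / 4 : ℝ)) ^ 4 = 2 := by
    rw [← Real.rpow_natCast, ← Real.rpow_mul (by norm_num : (0 : ℝ) ≤ 2)]
    norm_num
  rw [hpow] at h4
  norm_num at h4

/-! ### The convexity bound (Titchmarsh (5.1.4)) with an explicit constant -/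

/-- **Titchmarsh (5.1.4), explicit and unconditional: the convexity bound in the critical strip.**
For `½ ≤ σ ≤ 1` and `t ≥ 8`, `‖ζ(σ + it)‖ ≤ 32 · t^{(1−σ)/2} · log t`.
(Rademacher–Phragmén–Lindelöf between Lehman's `|ζ(½+iu)| ≤ 2.53|3+iu|^{1/4}` and the abscissa
`c = 1 + 1/log t`, where `ζ(c) ≤ 3 log t`; the exponent overshoot costs `e^{1/2}`.) RH-FREE.
[cite: Titchmarsh1986, §5.1 eq. (5.1.4)] [cite: Rademacher1959, Thm 2] [cite: Trudgian2011, Lemma 2.7] -/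
theorem norm_riemannZeta_le_convexity_strip {σ t : ℝ} (hσ : 1 / 2 ≤ σ) (hσ1 : σ ≤ 1)
    (ht : 8 ≤ t) : ‖riemannZeta (σ + t * I)‖ ≤ 32 * t ^ ((1 - σ) / 2) * Real.log t := by
  -- the logarithm `L = log t > 2` and the moving abscissa `c = 1 + 1/L`
  set L : ℝ := Real.log t with hL
  have hL2 : 2 < L := by
    rw [hL]; exact two_lt_log_eight.trans_le (Real.log_le_log (by norm_num) ht)
  have hLpos : 0 < L := by linarith
  set η : ℝ := 1 / L with hη
  have hη0 : 0 < η := by rw [hη]; positivity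
  have hη1 : η ≤ 1 / 2 := by
    rw [hη, div_le_div_iff₀ hLpos (by norm_num : (0 : ℝ) < 2)]; linarith
  have hηL : η * L = 1 := by rw [hη]; field_simp
  set c : ℝ := 1 + η with hc
  have hc1 : 1 < c := by rw [hc]; linarith
  have htpos : 0 < t := by linarith
  have ht1 : 1 ≤ t := by linarith
  -- the point `s = σ + it`
  set s : ℂ := (σ : ℂ) + t * I with hs
  have hsre : s.re = σ := by simp [hs]
  have hsim : s.im = t := by simp [hs]
  have hs1 : s ≠ 1 := fun h ↦ by
    have := congrArg Complex.im h
    rw [hsim] at this; simp at this; linarith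
  -- Rademacher–Phragmén–Lindelöf from Lehman's line bound, at THIS point with THIS `c`
  have hline := norm_riemannZeta_half_line_le_allT Trudgian2011_lemma_2_5_allT_holds
  have hconv := norm_riemannZeta_le_convexity (K := 2.53) (θ := 1 / 4) (Q := 5 / 2) (c := c)
    (by norm_num) (by norm_num) (by norm_num) hc1 hline (s := s) (by rw [hsre]; exact hσ)
    (by rw [hsre]; linarith) hs1
  rw [hsre] at hconv
  -- the four factors
  set a : ℝ := (c - σ) / (c - 1 / 2) with ha
  set b : ℝ := (σ - 1 / 2) / (c - 1 / 2) with hb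
  set N : ℝ := ‖((5 / 2 : ℝ) : ℂ) + s‖ with hN
  have hcden : 0 < c - 1 / 2 := by linarith
  have ha0 : 0 ≤ a := by rw [ha]; exact div_nonneg (by linarith) hcden.le
  have ha1 : a ≤ 1 := by rw [ha, div_le_one hcden]; linarith
  have hb0 : 0 ≤ b := by rw [hb]; exact div_nonneg (by linarith) hcden.le
  have hb1 : b ≤ 1 := by rw [hb, div_le_one hcden]; linarith
  -- (1) `K^a ≤ K`
  have hK : (2.53 : ℝ) ^ a ≤ 2.53 := by
    calc (2.53 : ℝ) ^ a ≤ (2.53 : ℝ) ^ (1 : ℝ) :=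
          Real.rpow_le_rpow_of_exponent_le (by norm_num) ha1
      _ = 2.53 := Real.rpow_one _
  -- (2) `ζ(c)^b ≤ 3 L`
  have hζc : (riemannZeta (c : ℂ)).re ≤ 3 * L := by
    have h1 := ZetaOneLine.norm_riemannZeta_one_add_le hη0 (by linarith : η ≤ 1)
    have hcast : (1 : ℂ) + (η : ℂ) = ((c : ℝ) : ℂ) := by rw [hc]; push_cast; ring
    rw [hcast, norm_riemannZeta_ofReal_eq_re hc1] at h1
    calc (riemannZeta (c : ℂ)).re ≤ 3 / η := h1
      _ = 3 * L := by rw [hη]; field_simp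
  have hζ1 : 1 ≤ (riemannZeta (c : ℂ)).re := one_le_re_riemannZeta_ofReal hc1
  have h3L : 1 ≤ 3 * L := by linarith
  have hZ : (riemannZeta (c : ℂ)).re ^ b ≤ 3 * L := by
    calc (riemannZeta (c : ℂ)).re ^ b ≤ (3 * L) ^ b :=
          Real.rpow_le_rpow (by linarith) hζc hb0
      _ ≤ (3 * L) ^ (1 : ℝ) := Real.rpow_le_rpow_of_exponent_le h3L hb1
      _ = 3 * L := Real.rpow_one _
  -- (3) geometry of `Q + s`: `t ≤ N ≤ 2t`, `‖s − 1‖ ≥ t`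
  have hNeq : ((5 / 2 : ℝ) : ℂ) + s = ((5 / 2 + σ : ℝ) : ℂ) + t * I := by
    rw [hs]; push_cast; ring
  have hN_le : N ≤ 2 * t := by
    rw [hN, hNeq]
    calc ‖((5 / 2 + σ : ℝ) : ℂ) + t * I‖ ≤ ‖((5 / 2 + σ : ℝ) : ℂ)‖ + ‖(t : ℂ) * I‖ := norm_add_le _ _
      _ = (5 / 2 + σ) + t := by
          rw [Complex.norm_real, Real.norm_eq_abs, abs_of_pos (by linarith), norm_mul,
            Complex.norm_I, mul_one, Complex.norm_real, Real.norm_eq_abs, abs_of_pos htpos]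
      _ ≤ 2 * t := by linarith
  have hN_ge : t ≤ N := by
    rw [hN, hNeq]
    have := Complex.abs_im_le_norm (((5 / 2 + σ : ℝ) : ℂ) + t * I)
    simp only [Complex.add_im, Complex.ofReal_im, Complex.mul_im, Complex.ofReal_re,
      Complex.I_im, Complex.I_re, mul_one, mul_zero, zero_add, add_zero] at this
    rwa [abs_of_pos htpos] at this
  have hN0 : 0 ≤ N := norm_nonneg _
  have hs1_ge : t ≤ ‖s - 1‖ := by
    have := Complex.abs_im_le_norm (s - 1)
    simp only [Complex.sub_im, Complex.one_im, sub_zero, hsim] at this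
    rwa [abs_of_pos htpos] at this
  have hs1pos : 0 < ‖s - 1‖ := lt_of_lt_of_le htpos hs1_ge
  -- (3a) the exponent `e = a/4` exceeds `(1−σ)/2` by at most `η/2`
  set e : ℝ := 1 / 4 * a with he
  have he0 : 0 ≤ e := by rw [he]; positivity
  have he4 : e ≤ 1 / 4 := by rw [he]; linarith
  have he_le : e ≤ (1 - σ) / 2 + η / 2 := by
    rw [he, ha, hc]
    have hden : (0 : ℝ) < 1 + η - 1 / 2 := by linarith
    rw [show (1 : ℝ) / 4 * ((1 + η - σ) / (1 + η - 1 / 2)) = (1 + η - σ) / (4 * (1 + η - 1 / 2)) by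
      field_simp]
    rw [div_le_iff₀ (by linarith)]
    nlinarith
  -- (3b) `N^e ≤ 2 t^{(1−σ)/2}`
  have hNe : N ^ e ≤ 2 * t ^ ((1 - σ) / 2) := by
    have h1 : N ^ e ≤ (2 * t) ^ e := Real.rpow_le_rpow hN0 hN_le he0
    have h2 : (2 * t) ^ e = (2 : ℝ) ^ e * t ^ e := Real.mul_rpow (by norm_num) htpos.le
    have h3 : (2 : ℝ) ^ e ≤ 6 / 5 :=
      (Real.rpow_le_rpow_of_exponent_le (by norm_num) he4).trans two_rpow_quarter_le
    have h4 : t ^ e ≤ t ^ ((1 - σ) / 2) * (5 / 3) := by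
      calc t ^ e ≤ t ^ ((1 - σ) / 2 + η / 2) := Real.rpow_le_rpow_of_exponent_le ht1 he_le
        _ = t ^ ((1 - σ) / 2) * t ^ (η / 2) := Real.rpow_add htpos _ _
        _ = t ^ ((1 - σ) / 2) * Real.exp (1 / 2) := by
            congr 1
            rw [Real.rpow_def_of_pos htpos, ← hL]
            congr 1
            rw [hη]; field_simp
        _ ≤ t ^ ((1 - σ) / 2) * (5 / 3) := by
            gcongr
            exact exp_half_le
    have ht0 : 0 ≤ t ^ ((1 - σ) / 2) := Real.rpow_nonneg htpos.le _
    calc N ^ e ≤ (2 : ℝ) ^ e * t ^ e := by rw [← h2]; exact h1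
      _ ≤ (6 / 5) * (t ^ ((1 - σ) / 2) * (5 / 3)) :=
          mul_le_mul h3 h4 (Real.rpow_nonneg htpos.le _) (by norm_num)
      _ = 2 * t ^ ((1 - σ) / 2) := by ring
  -- (4) `N/‖s−1‖ ≤ 2`
  have hratio : N / ‖s - 1‖ ≤ 2 := by
    rw [div_le_iff₀ hs1pos]; linarith
  -- assemble
  have ht0 : 0 ≤ t ^ ((1 - σ) / 2) := Real.rpow_nonneg htpos.le _
  calc ‖riemannZeta s‖
      ≤ (2.53 : ℝ) ^ a * (riemannZeta (c : ℂ)).re ^ b * N ^ e * (N / ‖s - 1‖) := hconv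
    _ ≤ 2.53 * (3 * L) * (2 * t ^ ((1 - σ) / 2)) * 2 := by
        gcongr
    _ = 30.36 * t ^ ((1 - σ) / 2) * L := by ring
    _ ≤ 32 * t ^ ((1 - σ) / 2) * L := by gcongr; norm_num

/-- **Titchmarsh (5.1.4), `∃`-form:** there are `C₀, t₀` with `‖ζ(σ + it)‖ ≤ C₀ t^{(1−σ)/2} log t`
for all `½ ≤ σ ≤ 1`, `t ≥ t₀` (`C₀ = 32`, `t₀ = 8`). RH-FREE. [cite: Titchmarsh1986, §5.1 eq. (5.1.4)] -/
theorem exists_norm_riemannZeta_le_convexity_strip :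
    ∃ C₀ t₀ : ℝ, ∀ σ t : ℝ, 1 / 2 ≤ σ → σ ≤ 1 → t₀ ≤ t →
      ‖riemannZeta ((σ : ℂ) + t * I)‖ ≤ C₀ * t ^ ((1 - σ) / 2) * Real.log t :=
  ⟨32, 8, fun _ _ hσ hσ1 ht ↦ norm_riemannZeta_le_convexity_strip hσ hσ1 ht⟩

/-- **The same bound in the `λ·(1 − σ)` exponent shape with `λ = ½`** (the cell rh-jensen's
`ZetaStripBound (1/2) 32 8`): for `½ ≤ σ ≤ 1`, `t ≥ 8`,
`‖ζ(σ + it)‖ ≤ 32 · t^{(1/2)(1−σ)} · log t`. RH-FREE. [cite: Titchmarsh1986, §5.1 eq. (5.1.4)] -/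
theorem zetaStripBound_half :
    ∀ σ t : ℝ, 1 / 2 ≤ σ → σ ≤ 1 → 8 ≤ t →
      ‖riemannZeta ((σ : ℂ) + t * Complex.I)‖ ≤ 32 * t ^ (1 / 2 * (1 - σ)) * Real.log t := by
  intro σ t hσ hσ1 ht
  rw [show (1 : ℝ) / 2 * (1 - σ) = (1 - σ) / 2 by ring]
  exact norm_riemannZeta_le_convexity_strip hσ hσ1 ht

end Literature.NumberTheory.LFunctions
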